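import Summits.CriticalPhenomena.CardyFormulaZ2.Theorems.CardyBondTriangularBondTriangularCardyWeakBoundary

/-!
# Route CardyBondTriangular · crux `BondTriangularCardy` (stmt-CriticalPhenomena-4664), line `birth`,
# stub `stub_corner`, helper: crossings of a discrete domain near a corner

Helper of the stub `stub_corner` (the corner normalisation `f²_δ(z_δ) → 1` at the marked point
`R.pt 1` of the weak boundary values, Bollobás–Riordan, *Percolation* (CUP 2006), Ch. 7,
pp. 200–201, run on the Chayes–Lei hexagon representation). Three model-free combinatorial
facts about a 4-marked discrete domain `G = (G; v₀, v₁, v₂, v₃)` of `𝕋` used there: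

* `clBlueGraph_reachable_of_darts` — a `𝕋`-walk of hexagons all of whose darts are blue
  adjacencies joins each of its hexagons to its end in the blue graph;
* `exists_mem_support_of_interleaved` — **interleaved boundary-to-boundary paths meet**: for
  boundary positions `n₁ < n₂ < n₃ < n₄ < n₁ + #∂`, a walk of sites of `G` from the tail of the
  dart at `n₂` to that at `n₄` meets every set `N` through which the tails at `n₁`, `n₃` are
  joined inside `G` (the exclusivity half of Lemma 5 of Bollobás–Riordan, p. 169, in the general
  position form `IsTriDisc.not_interleaved`, after rebasing the traversal at `n₁`);
* `exists_mem_support_near_of_blueCrossing` — its instance for the corner: if the tails at two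
  positions `m₁ ≤ pos 1 < m₂` are joined to `v₁` through `N`, every walk of sites of `G` from a
  tail of `[m₁, m₂)` to a tail of `[m₃, m₀ + #∂)` (`m₀ ≤ m₁`, `m₂ < m₃`) meets `N`;
* `exists_corner_remark` — **re-marking for the blocking theorem at the corner `v₁`**: for a
  markable position `X` strictly between `pos 1` and `pos 2 - 1` whose tail is not `v₀`, the
  4-marked domain `(G; x_X, v₂, v₀, v₁)` on the same sites has fourth marked site `v₁`, its
  stretch `1` is the last stretch of the 3-marked domain `(G; v₀, v₁, v₂)` (positions
  `[pos 2, #∂)`), its arc `0` contains the tails of `[X, pos 2)` and its arc `2` those of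
  `[0, pos 1)` (the pattern of `exists_remark_rotate`).

References: B. Bollobás, O. Riordan, *Percolation*, CUP 2006, Ch. 7, Lemma 5 p. 169, proof of
Claim 23 pp. 200–201.
-/

noncomputable section

namespace Summit.CriticalPhenomena.CardyFormulaZ2.Theorems.BondTriangularCardyLine

open Finset
open Literature.Probability.Percolation Literature.Probability.LatticeModels

/-! ### Blue paths of hexagons as walks in the blue graph -/

/-- A `𝕋`-walk all of whose darts are blue adjacencies joins every site of its support to its
end in the blue graph. -/
theorem clBlueGraph_reachable_of_darts {σ : CLHexConfig} {u v : Site 2} (P : triGraph.Walk u v)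
    (hdarts : ∀ d ∈ P.darts, (clBlueGraph σ).Adj d.fst d.snd) {x : Site 2} (hx : x ∈ P.support) :
    (clBlueGraph σ).Reachable x v := by
  classical
  have hedges : ∀ e ∈ P.edges, e ∈ (clBlueGraph σ).edgeSet := by
    intro e he
    rw [SimpleGraph.Walk.edges, List.mem_map] at he
    obtain ⟨d, hd, rfl⟩ := he
    rw [show d.edge = s(d.fst, d.snd) from rfl, SimpleGraph.mem_edgeSet]
    exact hdarts d hd
  set Q := P.transfer (clBlueGraph σ) hedges with hQ
  have hxQ : x ∈ Q.support := by rw [hQ, SimpleGraph.Walk.support_transfer]; exact hx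
  exact ⟨Q.dropUntil x hxQ⟩

/-! ### Interleaved boundary-to-boundary paths meet -/

/-- **Interleaved boundary-to-boundary paths of a discrete domain meet.** For positions
`n₁ < n₂ < n₃ < n₄ < n₁ + #∂` of the boundary cycle of a marked discrete domain, if the tails of
the darts at `n₁` and `n₃` are joined by a path of sites of `G` inside the set `N`, then every
`𝕋`-walk of sites of `G` from the tail at `n₂` to the tail at `n₄` has a site in `N` (otherwise
the two would be interleaved disjoint paths, `IsTriDisc.not_interleaved`, after rebasing the
traversal at the dart at `n₁`). (Bollobás–Riordan 2006, Ch. 7, Lemma 5 p. 169, exclusivity.) -/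
theorem exists_mem_support_of_interleaved {k : ℕ} (D : TriMarkedDomain k) (N : Set (Site 2))
    {n₁ n₂ n₃ n₄ : ℕ} (h12 : n₁ < n₂) (h23 : n₂ < n₃) (h34 : n₃ < n₄)
    (h4 : n₄ < n₁ + #(triBdryDarts D.verts))
    (hQ : PathIn triGraph ((D.verts : Set (Site 2)) ∩ N) (triBdryIter D.verts D.base n₁).1
      (triBdryIter D.verts D.base n₃).1)
    (W : triGraph.Walk (triBdryIter D.verts D.base n₂).1 (triBdryIter D.verts D.base n₄).1)
    (hW : ∀ x ∈ W.support, x ∈ D.verts) : ∃ x ∈ W.support, x ∈ N := by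
  by_contra hno
  push Not at hno
  have hW' : PathIn triGraph ((D.verts : Set (Site 2)) ∩ Nᶜ) (triBdryIter D.verts D.base n₂).1
      (triBdryIter D.verts D.base n₄).1 :=
    PathIn.of_walk W fun x hx => ⟨Finset.mem_coe.2 (hW x hx), hno x hx⟩
  have hb : triBdryIter D.verts D.base n₁ ∈ triBdryDarts D.verts := triBdryIter_mem D.base_mem n₁
  have hD := D.isTriDisc.rebase hb
  have e : ∀ n, n₁ ≤ n →
      triBdryIter D.verts (triBdryIter D.verts D.base n₁) (n - n₁) = triBdryIter D.verts D.base n :=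
    fun n hn => by rw [← triBdryIter_add, Nat.add_sub_cancel' hn]
  refine hD.not_interleaved N (n₁ := 0) (n₂ := n₂ - n₁) (n₃ := n₃ - n₁) (n₄ := n₄ - n₁)
    (by omega) (by omega) (by omega) (by omega) ?_ ?_
  · rw [e n₃ (by omega)]
    exact hQ
  · rw [e n₂ (by omega), e n₄ (by omega)]
    exact hW'

/-- **Blue crossings near the corner meet the near set.** Let `m₀ ≤ m₁ ≤ pos 1 < m₂ < m₃` be
boundary positions of the 4-marked domain `G`, and let the tails at `m₁` and at `m₂` be joined to
the marked site `v₁` by paths of sites of `G` inside `N`. Then every `𝕋`-walk of sites of `G`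
from the tail of a position of `[m₁, m₂)` to the tail of a position of `[m₃, m₀ + #∂)` has a site
in `N`: either it starts at the tail of `m₁` or at `v₁`, or its ends are interleaved with
`m₁ < · < pos 1` or with `pos 1 < · < m₂` (`exists_mem_support_of_interleaved`). -/
theorem exists_mem_support_near_of_blueCrossing (G : TriMarkedDomain 4) {m₀ m₁ m₂ m₃ : ℕ}
    (h01 : m₀ ≤ m₁) (h1 : m₁ ≤ G.pos 1) (h2 : G.pos 1 < m₂) (h23 : m₂ < m₃) (N : Set (Site 2))
    (hN1 : PathIn triGraph ((G.verts : Set (Site 2)) ∩ N) (triBdryIter G.verts G.base m₁).1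
      (G.markSite 1))
    (hN2 : PathIn triGraph ((G.verts : Set (Site 2)) ∩ N) (G.markSite 1)
      (triBdryIter G.verts G.base m₂).1)
    {nt ne : ℕ} (ht1 : m₁ ≤ nt) (ht2 : nt < m₂) (he1 : m₃ ≤ ne)
    (he2 : ne < m₀ + #(triBdryDarts G.verts))
    (W : triGraph.Walk (triBdryIter G.verts G.base nt).1 (triBdryIter G.verts G.base ne).1)
    (hW : ∀ x ∈ W.support, x ∈ G.verts) : ∃ x ∈ W.support, x ∈ N := by
  have hv1 : G.markSite 1 = (triBdryIter G.verts G.base (G.pos 1)).1 := rfl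
  rcases lt_trichotomy nt (G.pos 1) with hlt | heq | hgt
  · rcases eq_or_lt_of_le ht1 with heq1 | hlt1
    · subst heq1
      exact ⟨_, W.start_mem_support, (hN1.left_mem).2⟩
    · rw [hv1] at hN1
      exact exists_mem_support_of_interleaved G N hlt1 hlt (by omega) (by omega) hN1 W hW
  · refine ⟨_, W.start_mem_support, ?_⟩
    rw [heq, ← hv1]
    exact (hN2.left_mem).2
  · rw [hv1] at hN2
    exact exists_mem_support_of_interleaved G N hgt ht2 (by omega) (by omega) hN2 W hW

/-! ### Re-marking for the blocking theorem at the corner -/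

/-- **The 4-marked domain `(G; x_X, v₂, v₀, v₁)`.** For a markable position `X` of the boundary
cycle of `G = (G; v₀, v₁, v₂, v₃)` with `pos 1 < X`, `X + 1 < pos 2` and tail `x_X ≠ v₀`, the
domain on the same sites marked at `x_X, v₂, v₀, v₁` (positions `X < pos 2 < #∂ < #∂ + pos 1`,
`remark`) has fourth marked site `v₁`, stretch `1` equal to the last stretch of `(G; v₀, v₁, v₂)`
(positions `[pos 2, #∂)`), arc `0` containing the tails of `[X, pos 2)` and arc `2` containing the
tails of `[0, pos 1)` (Bollobás–Riordan 2006, p. 201: "the 4-marked domain obtained from the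
3-marked domain … by taking `x_δ` as the fourth marked point", here at the corner `v₁`). -/
theorem exists_corner_remark : ∀ (G : Literature.Probability.Percolation.TriMarkedDomain 4) (X : ℕ), G.pos 1 < X → X + 1 < G.pos 2 → G.Markable X → (Literature.Probability.Percolation.triBdryIter G.verts G.base X).1 ≠ G.markSite 0 → ∃ D : Literature.Probability.Percolation.TriMarkedDomain 4, D.verts = G.verts ∧ D.markSite 3 = G.markSite 1 ∧ D.stretch 1 = G.dropLast.stretch 2 ∧ (∀ n, X ≤ n → n < G.pos 2 → (Literature.Probability.Percolation.triBdryIter G.verts G.base n).1 ∈ D.arc 0) ∧ (∀ n, n < G.pos 1 → (Literature.Probability.Percolation.triBdryIter G.verts G.base n).1 ∈ D.arc 2) := by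
  intro G X hX1 hX2 hmk hX0
  set L := #(triBdryDarts G.verts) with hLdef
  have h2L : G.pos 2 < L := G.pos_lt 2
  have hp1 := G.two_le_pos_one
  have hp0 : G.pos 0 = 0 := G.pos_zero_eq
  set m : Fin 4 → ℕ := ![X, G.pos 2, L, L + G.pos 1] with hm
  have hm0 : m 0 = X := rfl
  have hm1 : m 1 = G.pos 2 := rfl
  have hm2 : m 2 = L := rfl
  have hm3 : m 3 = L + G.pos 1 := rfl
  have hmono : StrictMono m := by
    refine Fin.strictMono_iff_lt_succ.2 fun i => ?_
    fin_cases i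
    · show X < G.pos 2; omega
    · show G.pos 2 < L; exact h2L
    · show L < L + G.pos 1; omega
  have hLm : ∀ j, m j < m 0 + #(triBdryDarts G.verts) := by
    intro j
    have : m j ≤ L + G.pos 1 := hmono.monotone (Fin.le_last j)
    rw [hm0]; omega
  have hmk' : ∀ j, G.Markable (m j) := by
    intro j; fin_cases j
    · exact hmk
    · exact G.markable_pos 2
    · show G.Markable L
      have := G.markable_pos 0
      rw [hp0] at this
      rw [← add_zero L]; exact G.markable_card_add.2 this
    · exact G.markable_card_add.2 (G.markable_pos 1)
  have ht1 : (triBdryIter G.verts G.base (m 1)).1 = G.markSite 2 := rfl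
  have ht2 : (triBdryIter G.verts G.base (m 2)).1 = G.markSite 0 := by
    rw [hm2, ← zero_add L, G.iter_add_card]
    show (triBdryIter G.verts G.base 0).1 = (triBdryIter G.verts G.base (G.pos 0)).1
    rw [hp0]
  have ht3 : (triBdryIter G.verts G.base (m 3)).1 = G.markSite 1 := by
    rw [hm3, G.iter_card_add]; rfl
  have hX1' : (triBdryIter G.verts G.base X).1 ≠ G.markSite 1 :=
    G.fst_ne_markSite_of_markable hmk hX1 (by omega) hp1
  have hX2' : (triBdryIter G.verts G.base X).1 ≠ G.markSite 2 :=
    G.fst_ne_markSite_of_lt hX2 (by omega)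
  have hI := G.mark_injective
  have hinj : Function.Injective fun j => (triBdryIter G.verts G.base (m j)).1 := by
    refine TriMarkedDomain.injective_fin_four ?_ ?_ ?_ ?_ ?_ ?_
    · show (triBdryIter G.verts G.base (m 0)).1 ≠ (triBdryIter G.verts G.base (m 1)).1
      rw [ht1]; exact hX2'
    · show (triBdryIter G.verts G.base (m 0)).1 ≠ (triBdryIter G.verts G.base (m 2)).1
      rw [ht2]; exact hX0
    · show (triBdryIter G.verts G.base (m 0)).1 ≠ (triBdryIter G.verts G.base (m 3)).1
      rw [ht3]; exact hX1'
    · show (triBdryIter G.verts G.base (m 1)).1 ≠ (triBdryIter G.verts G.base (m 2)).1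
      rw [ht1, ht2]; exact fun h => absurd (hI (show G.markSite 2 = G.markSite 0 from h)) (by decide)
    · show (triBdryIter G.verts G.base (m 1)).1 ≠ (triBdryIter G.verts G.base (m 3)).1
      rw [ht1, ht3]; exact fun h => absurd (hI (show G.markSite 2 = G.markSite 1 from h)) (by decide)
    · show (triBdryIter G.verts G.base (m 2)).1 ≠ (triBdryIter G.verts G.base (m 3)).1
      rw [ht2, ht3]; exact fun h => absurd (hI (show G.markSite 0 = G.markSite 1 from h)) (by decide)
  have hN0 : G.remarkNext m 0 = G.pos 2 := rfl
  have hN1' : G.remarkNext m 1 = L := rfl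
  have hN2' : G.remarkNext m 2 = L + G.pos 1 := rfl
  refine ⟨G.remark m hmono hLm hmk' hinj, rfl, ?_, ?_, ?_, ?_⟩
  · rw [G.remark_markSite m hmono hLm hmk' hinj 3, ht3]
  · rw [G.remark_stretch m hmono hLm hmk' hinj 1, hN1', hm1, G.dropLast_stretch_two_eq]
  · intro n hn1 hn2
    exact (G.mem_remark_arc_iff m hmono hLm hmk' hinj 0).2 ⟨n, hn1, by rw [hN0]; exact hn2, rfl⟩
  · intro n hn
    refine (G.mem_remark_arc_iff m hmono hLm hmk' hinj 2).2
      ⟨L + n, by rw [hm2]; omega, by rw [hN2']; omega, ?_⟩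
    rw [G.iter_card_add]

end Summit.CriticalPhenomena.CardyFormulaZ2.Theorems.BondTriangularCardyLine

end
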